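import Literature.NumberTheory.QuadraticFields.FundamentalDiscriminant
import Literature.NumberTheory.QuadraticFields.KroneckerCharacterFourProofs
import Literature.NumberTheory.QuadraticFields.JacobiCharacter
import HarnessLib

/-!
# The Kronecker character of a quadratic field exists as a Dirichlet character mod `|d_K|` (PROVED)

Topic `NumberTheory/QuadraticFields`; seat `rh-explicit-goldfeld-census-2` (GOLDFELD track of the
`rh-explicit` cell). Everything here is PROVED (one theorem, no definitions, no named facts).

Several tree statements about a quadratic field `K` take "its quadratic character" as ANY
Dirichlet character `κ` mod `d = |d_K|` with the Kronecker values at the primes — `κ(p) = (d_K/p)`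
(Jacobi symbol) for odd primes `p`, and `κ(2) = 1, −1, 0` according as `d_K ≡ 1, 5 (mod 8)` or
`d_K` even (hypotheses `hoddp` / `htwo` of `Quadratic.finprod_primesOver_eq_of_kronecker`,
`Oesterle1985_proposition_2`, `oesterle_coprime_5077'`). `exists_kroneckerChar` supplies such a
`κ` for every quadratic field, so that those statements can be used without a character in hand:
for odd `d_K` (`≡ 1 (mod 4)`) it is the tree's `jacobiChar |d_K|` (`n ↦ (n/|d_K|)`, equal to
`(d_K/n)` at odd primes by the reciprocity lemma `jacobiSym_natAbs_eq_of_emod_four_eq_one`, and at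
`2` by `jacobiSym_two_natAbs_eq_one_iff` / `…_neg_one_iff`); for even `d_K = 4m` it is the
character mod `4|m|` of `exists_dirichletCharacter_four_mul` (`KroneckerCharacterFourProofs.lean`,
values `(m/n)` at odd `n`, `0` at even residues), transported along `|d_K| = 4|m|`
(Cox, *Primes of the form x² + ny²*, §1.C Lemma 1.14 and (1.18): the Kronecker symbol `(D/·)` is a
character mod `|D|`). Used by `oesterle_theoreme1_coprime_5077` (`Oesterle5077Family.lean`).

## References

* [Cox2013] D. A. Cox, *Primes of the form x² + ny²*, 2nd ed. (2013), §1.C Lemma 1.14, (1.18).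
-/

noncomputable section

open scoped Classical NumberTheorySymbols

namespace Literature.NumberTheory.QuadraticFields

open Literature.NumberTheory.QuadraticFields.Quadratic

/-- **Existence of the Kronecker character** of a quadratic field `K` as a Dirichlet character
mod `|d_K|` with the values `(d_K/p)` at odd primes `p` and `1, −1, 0` at `2` according as
`d_K ≡ 1, 5 (mod 8)` or `d_K` is even (Cox, Lemma 1.14 / (1.18)). Odd `d_K`: the Jacobi character
`n ↦ (n/|d_K|)` (reciprocity for `d_K ≡ 1 (mod 4)`); even `d_K = 4m`: the character mod `4|m|`
with values `(m/n)` at odd `n`. [cite: Cox2013, §1.C Lemma 1.14] -/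
theorem exists_kroneckerChar {K : Type*} [Field K] [NumberField K]
    (h2 : Module.finrank ℚ K = 2) :
    ∃ κ : DirichletCharacter ℂ (NumberField.discr K).natAbs,
      (∀ p : ℕ, p.Prime → p ≠ 2 → κ p = (jacobiSym (NumberField.discr K) p : ℂ)) ∧
      (κ 2 = if NumberField.discr K % 8 = 1 then 1
        else if NumberField.discr K % 8 = 5 then -1 else 0) := by
  set D := NumberField.discr K with hDdef
  have hD0 : D ≠ 0 := NumberField.discr_ne_zero K
  haveI : NeZero D.natAbs := ⟨Int.natAbs_ne_zero.mpr hD0⟩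
  rcases discr_emod_four h2 with h4 | h4
  · -- even discriminant `D = 4m`
    obtain ⟨m, hm⟩ : (4 : ℤ) ∣ D := Int.dvd_of_emod_eq_zero h4
    have hm0 : m ≠ 0 := by rintro rfl; exact hD0 (by rw [hm, mul_zero])
    have hd : D.natAbs = 4 * m.natAbs := by omega
    -- the character mod `4|m|`, with its values at odd `n` and at `2`, transported to mod `|D|`
    obtain ⟨κ, hκodd, hκ2⟩ : ∃ κ : DirichletCharacter ℂ D.natAbs,
        (∀ n : ℕ, Odd n → κ n = (J(m | n) : ℂ)) ∧ κ 2 = 0 := by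
      rw [hd]
      obtain ⟨χ, hχ⟩ := exists_dirichletCharacter_four_mul m hm0
      haveI : NeZero (4 * m.natAbs) := ⟨by omega⟩
      refine ⟨χ, hχ, ?_⟩
      have h2val : Even ((2 : ZMod (4 * m.natAbs)).val) := by
        have h2c : (2 : ZMod (4 * m.natAbs)) = ((2 : ℕ) : ZMod (4 * m.natAbs)) := by norm_cast
        rw [h2c, ZMod.val_natCast, Nat.mod_eq_of_lt (by omega)]
        exact ⟨1, rfl⟩
      exact apply_eq_zero_of_even h2val
    refine ⟨κ, fun p hp hp2 => ?_, ?_⟩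
    · have hpodd : Odd p := hp.odd_of_ne_two hp2
      have hgcd : (2 : ℤ).gcd p = 1 := by
        rw [show (2 : ℤ) = ((2 : ℕ) : ℤ) from rfl, Int.gcd_natCast_natCast]
        exact (Nat.coprime_primes Nat.prime_two hp).mpr (Ne.symm hp2)
      rw [hκodd p hpodd, hm, jacobiSym.mul_left, show (4 : ℤ) = 2 ^ 2 by norm_num,
        jacobiSym.sq_one' hgcd, one_mul]
    · have h81 : D % 8 ≠ 1 := by omega
      have h85 : D % 8 ≠ 5 := by omega
      rw [hκ2, if_neg h81, if_neg h85]
  · -- odd discriminant `D ≡ 1 (mod 4)`: the Jacobi character `(·/|D|)`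
    refine ⟨jacobiChar D.natAbs, fun p hp hp2 => ?_, ?_⟩
    · rw [jacobiChar_natCast, jacobiSym_natAbs_eq_of_emod_four_eq_one h4 (hp.odd_of_ne_two hp2)]
    · rw [← Nat.cast_ofNat, jacobiChar_natCast, Nat.cast_ofNat]
      by_cases h81 : D % 8 = 1
      · rw [if_pos h81, (jacobiSym_two_natAbs_eq_one_iff h4).mpr h81, Int.cast_one]
      · have h85 : D % 8 = 5 := by omega
        rw [if_neg h81, if_pos h85, (jacobiSym_two_natAbs_eq_neg_one_iff h4).mpr h85]
        push_cast
        ring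

end Literature.NumberTheory.QuadraticFields

end
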